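/-
COR-CM (cell pub-hodgecm2, stage 2 of the Hodge ladder) — count-neutral KERNEL COMBINATORICS «cyclic Galois CM fields: the instance»
(seat prover-pub-hodgecm2-b23-g39-0, binder prover b23, gen 39; claim CYCLIC-FIELDS F1, HOME/INBOX.md l.9351).  Theorems only; no
geometry beyond the by-name theorems of `CorCM/FaceCyclicGeneration.lean` (gen 38); seat b04's
`CyclicComposite.cm_normal_cyclic_finrank_of_prime_pow`, seat b09's floors and the INT2-GEN socket are used BY NAME; `Interfaces.lean`
(C1), every E term, B01 and `Transposition/*` are untouched.
HONEST FRAMING (COORDINATOR RULING — HODGE FRAMING CORRECTION, 2026-08-21T11:55:35Z): `HC_CM` is NOT proved, here or anywhere in the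
tree; this file produces no period and proves no face period for any field.
T5: n/a-class — the only Prop hypothesis binder displayed is INT2-GEN's period hypothesis on the produced face set (§3); no named-fact /
conjecture-def binder; checker: self (prover-pub-hodgecm2-b23-g39-0), 2026-08-22.
-/
import Summits.HodgeConjecture.CorCM.FaceCyclicGeneration
import Summits.HodgeConjecture.CorCM.FaceCensusOddSliceTransport
import Summits.HodgeConjecture.CorCM.CyclicCMTypesPrimePower
import HarnessLib

/-!
# Cyclic Galois CM fields: the instance `IsCyclic (GalT F)` from the Galois group, and the `β − 1` face theorems for `ℚ(ζ_{p^k})`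

Every «cyclic» field-form in the census programme — seat b09's block count `FaceParity.card_block_mul_finrank_of_isCyclic` and floors
`FaceParity.card_block_le_card_add_one_of_hgen_of_isCyclic`, `FaceCoinvariant.fibreTwo_add_one_eq_card_block_of_isCyclic`,
`FaceHalfParity.halfRank_eq_zero_of_isCyclic`, and this seat's `FaceCyclic.exists_faces_hgen_of_isCyclic` /
`isLeast_card_faces_hgen_of_isCyclic` / `hodgeConjectureFor_of_isCyclic_of_exists_facePeriod` (`CorCM/FaceCyclicGeneration.lean`) —
displays the instance binder `[IsCyclic (GalT F)]` on the group `GalT F` of Galois translates of `Hom(F, ℂ)` (`CorCM/CM/LefschetzChar1.lean`).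
This file inhabits that binder from the Galois group and removes it from the statements.

* §1 **`isCyclic_galT_iff`**: for `F/ℚ` Galois, `GalT F` is cyclic iff `Aut(F) = F ≃ₐ[ℚ] F` is — transport along the multiplicative
  bijection `FaceCensus.OddSlice.galTOfAut σ₀ : Aut(F) ≃ GalT F`, `g ↦ translate σ₀ (σ₀ ∘ g)` (`galTOfAut_mul`), read as a `MulEquiv`;
  generator form `isCyclic_galT_of_zpowers` (the datum `hg : ∀ x, x ∈ zpowers g` of `Census/OddSliceFaceTransport.lean`).
* §2 **cyclotomic fields**: `isCyclic_galT_of_isCyclotomicExtension` — an `n`-th cyclotomic extension of `ℚ` with `(ℤ/n)ˣ` cyclic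
  (Mathlib `IsCyclotomicExtension.autEquivPow`; `n = p^k, 2p^k` by `ZMod.isCyclic_units_iff`) has cyclic `GalT`; the prime-power case
  `isCyclic_galT_of_isCyclotomicExtension_prime_pow` (`p` an odd prime; seat b04's `CyclicComposite.cm_normal_cyclic_finrank_of_prime_pow`
  BY NAME) and the prime case `isCyclic_galT_of_isCyclotomicExtension_prime`; the degree `finrank_of_isCyclotomicExtension_prime_pow`
  (`= p^{k-1}(p−1)`; prime case `= p − 1`) and `six_le_finrank_of_isCyclotomicExtension_prime_pow` (`p^k ≥ 7 ⟹ [F:ℚ] ≥ 6`).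
* §3 **the `β − 1` face theorems without the instance binder** (gen 38's three theorems BY NAME): generator forms
  `exists_faces_hgen_of_zpowers`, `isLeast_card_faces_hgen_of_zpowers`, `hodgeConjectureFor_of_zpowers_of_exists_facePeriod`, and
  the cyclotomic forms `exists_faces_hgen_of_isCyclotomicExtension_prime_pow`, `isLeast_card_faces_hgen_of_isCyclotomicExtension_prime_pow`,
  **`hodgeConjectureFor_of_isCyclotomicExtension_prime_pow_of_exists_facePeriod`** (and the `{p}`-indexed twins `…_prime`, since the
  instances `IsCyclotomicExtension {p} ℚ K` and `IsCyclotomicExtension {p ^ 1} ℚ K` differ syntactically): for `K` a CM field which is a `p^k`-th cyclotomic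
  extension of `ℚ` (`p` an odd prime, `p^k ≥ 7`, i.e. `ℚ(ζ₇), ℚ(ζ₉), ℚ(ζ₁₁), ℚ(ζ₁₃), ℚ(ζ₂₅), ℚ(ζ₂₇), …`) and any base embedding `σ₀`
  there is a set `𝒮` of EXACTLY `β(K) − 1` rank-four faces with the INT2-GEN generation binder `hgen(𝒮, σ₀)`, no smaller set has it, and
  IF each face of `𝒮` has a non-vanishing period on the universe of record THEN the Hodge conjecture holds for every abelian variety
  dominated by a product of CM abelian varieties with CM by subfields of `K` — CONDITIONAL on those periods; `HC_CM` is NOT proved.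
  Here `β(K)·[K:ℚ] = Σ_{d ∣ [K:ℚ], d odd} φ(d)·2^{[K:ℚ]/2/d}` (b09's `FaceParity.card_block_mul_finrank_of_isCyclic`); the numerals
  (`[K:ℚ] = 6, 10, 12, 18, 20, …` ⟹ `β − 1 = 1, 3, 5, 29, 51, …`) are the sequel `CorCM/FaceCyclicBlockNumerals.lean`.

References: [cite: Washington1997, Thm. 2.5, Prop. 2.7] (Galois group of `ℚ(ζ_n)` is `(ℤ/n)ˣ`; cyclic for `n = p^k`, `p` odd);
[cite: Pohlmann1968, Thm. 1]; [cite: Milne1999LefschetzClasses, Thm. 3.2]; [cite: Shimura1998, §8.1 (p. 62)].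
-/

noncomputable section

open CategoryTheory NumberField NumberField.ComplexEmbedding
open Literature.AlgebraicGeometry Literature.AlgebraicGeometry.Motives Literature.AlgebraicGeometry.HodgeTheory
open Literature.AlgebraicGeometry.ComplexMultiplication Literature.AlgebraicGeometry.Milne1999
open Literature.NumberTheory.Automorphic
open Literature.NumberTheory.Automorphic.PicardCM
open Summit.HodgeConjecture.CorCM.Domination

namespace Summit.HodgeConjecture.CorCM.FaceCyclic

open Summit.HodgeConjecture.CorCM.Prior.AllgGroup.RfwfAllgGroup
open Summit.HodgeConjecture.CorCM.Census.BlockParity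
open Summit.HodgeConjecture.CorCM.Census.Coinvariant
open Summit.HodgeConjecture.CorCM.FaceCensus.OddSlice (galTOfAut galTOfAut_mul)

/-! ## §1 `GalT F` is cyclic iff the Galois group is -/

section Group

variable {F : Type} [Field F] [NumberField F]

/-- A number field has a complex embedding. [folklore] -/
private theorem nonempty_embedding : Nonempty (F →+* ℂ) := by
  have hc : 0 < Fintype.card (F →+* ℂ) := by
    rw [Embeddings.card]; exact Module.finrank_pos
  exact Fintype.card_pos_iff.mp hc

/-- **`GalT F` is cyclic iff `Aut(F)` is** (`F/ℚ` Galois): transport of structure along the multiplicative bijection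
`galTOfAut σ₀ : Aut(F) ≃ GalT F` of `CorCM/FaceCensusOddSliceTransport.lean`. [folklore] -/
theorem isCyclic_galT_iff [IsGalois ℚ F] : IsCyclic (GalT F) ↔ IsCyclic (F ≃ₐ[ℚ] F) := by
  obtain ⟨σ₀⟩ := nonempty_embedding (F := F)
  exact (MulEquiv.isCyclic (MulEquiv.mk' (galTOfAut σ₀) (galTOfAut_mul σ₀))).symm

/-- **A cyclic Galois group gives a cyclic `GalT F`.** [folklore] -/
theorem isCyclic_galT_of_isCyclic_aut [IsGalois ℚ F] (h : IsCyclic (F ≃ₐ[ℚ] F)) : IsCyclic (GalT F) :=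
  isCyclic_galT_iff.mpr h

/-- **Generator form**: if every automorphism of `F` is a power of `g`, then `GalT F` is cyclic (the datum `hg` of
`Census/OddSliceFaceTransport.lean`). [folklore] -/
theorem isCyclic_galT_of_zpowers [IsGalois ℚ F] {g : F ≃ₐ[ℚ] F} (hg : ∀ x, x ∈ Subgroup.zpowers g) : IsCyclic (GalT F) :=
  isCyclic_galT_of_isCyclic_aut ⟨⟨g, fun x => Subgroup.mem_zpowers_iff.mp (hg x)⟩⟩

/-- Conversely a cyclic `GalT F` gives a generator of `Aut(F)`. [folklore] -/
theorem exists_zpowers_of_isCyclic_galT [IsGalois ℚ F] [IsCyclic (GalT F)] : ∃ g : F ≃ₐ[ℚ] F, ∀ x, x ∈ Subgroup.zpowers g := by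
  haveI : IsCyclic (F ≃ₐ[ℚ] F) := isCyclic_galT_iff.mp ‹_›
  exact IsCyclic.exists_generator

/-! ## §2 Cyclotomic fields -/

/-- **An `n`-th cyclotomic extension of `ℚ` with `(ℤ/n)ˣ` cyclic has cyclic `GalT`** (`Aut(F) ≃* (ℤ/n)ˣ`, Mathlib
`IsCyclotomicExtension.autEquivPow`). [cite: Washington1997, Thm. 2.5] -/
theorem isCyclic_galT_of_isCyclotomicExtension {n : ℕ} [NeZero n] [IsCyclotomicExtension {n} ℚ F] (hn : IsCyclic (ZMod n)ˣ) :
    IsCyclic (GalT F) := by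
  haveI := IsCyclotomicExtension.isGalois {n} ℚ F
  exact isCyclic_galT_of_isCyclic_aut
    ((IsCyclotomicExtension.autEquivPow F (Polynomial.cyclotomic.irreducible_rat (NeZero.pos n))).isCyclic.mpr hn)

/-- **`ℚ(ζ_{p^k})`, `p` an odd prime: cyclic `GalT`** (seat b04's `CyclicComposite.cm_normal_cyclic_finrank_of_prime_pow`: Galois group
`(ℤ/p^k)ˣ` cyclic of order `p^{k−1}(p−1)`). [cite: Washington1997, Thm. 2.5, Prop. 2.7] -/
theorem isCyclic_galT_of_isCyclotomicExtension_prime_pow {p k : ℕ} (hp : p.Prime) (hp2 : p ≠ 2) (hk : 0 < k)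
    [IsCyclotomicExtension {p ^ k} ℚ F] : IsCyclic (GalT F) := by
  haveI := IsCyclotomicExtension.isGalois {p ^ k} ℚ F
  exact isCyclic_galT_of_isCyclic_aut (CyclicComposite.cm_normal_cyclic_finrank_of_prime_pow hp hp2 hk F).2.2.1

/-- **`ℚ(ζ_p)`, `p` an odd prime: cyclic `GalT`.** [cite: Washington1997, Thm. 2.5] -/
theorem isCyclic_galT_of_isCyclotomicExtension_prime {p : ℕ} (hp : p.Prime) [IsCyclotomicExtension {p} ℚ F] :
    IsCyclic (GalT F) := by
  haveI : NeZero p := ⟨hp.ne_zero⟩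
  exact isCyclic_galT_of_isCyclotomicExtension (ZMod.isCyclic_units_prime hp)

/-- `ℚ(ζ_{p^k})` is Galois over `ℚ`. [cite: Washington1997, Thm. 2.5] -/
theorem isGalois_of_isCyclotomicExtension_prime_pow (p k : ℕ) [IsCyclotomicExtension {p ^ k} ℚ F] : IsGalois ℚ F :=
  IsCyclotomicExtension.isGalois {p ^ k} ℚ F

/-- `[ℚ(ζ_{p^k}) : ℚ] = p^{k−1}(p−1)` for `p` an odd prime, `k ≥ 1` (b04 BY NAME). [cite: Washington1997, Prop. 2.7] -/
theorem finrank_of_isCyclotomicExtension_prime_pow {p k : ℕ} (hp : p.Prime) (hp2 : p ≠ 2) (hk : 0 < k)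
    [IsCyclotomicExtension {p ^ k} ℚ F] : Module.finrank ℚ F = p ^ (k - 1) * (p - 1) :=
  (CyclicComposite.cm_normal_cyclic_finrank_of_prime_pow hp hp2 hk F).2.2.2

/-- `p^k ≥ 7` (`p` an odd prime) forces `k ≥ 1` and `[ℚ(ζ_{p^k}) : ℚ] = p^{k−1}(p−1) ≥ 6`. [folklore] -/
theorem six_le_finrank_of_isCyclotomicExtension_prime_pow {p k : ℕ} (hp : p.Prime) (hp2 : p ≠ 2) (h7 : 7 ≤ p ^ k)
    [IsCyclotomicExtension {p ^ k} ℚ F] : 6 ≤ Module.finrank ℚ F := by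
  have h3 : 3 ≤ p := by have := hp.two_le; omega
  have hk : 0 < k := by
    rcases Nat.eq_zero_or_pos k with rfl | hk
    · rw [pow_zero] at h7; omega
    · exact hk
  rw [finrank_of_isCyclotomicExtension_prime_pow hp hp2 hk]
  rcases Nat.lt_or_ge k 2 with hk1 | hk2
  · have hk1' : k = 1 := by omega
    subst hk1'
    rw [pow_one] at h7
    simp only [Nat.sub_self, pow_zero, one_mul]
    omega
  · have hpk : 3 ≤ p ^ (k - 1) :=
      le_trans h3 (le_trans (le_of_eq (pow_one p).symm) (Nat.pow_le_pow_right hp.pos (by omega)))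
    have hp1 : 2 ≤ p - 1 := by omega
    calc 6 = 3 * 2 := by norm_num
      _ ≤ p ^ (k - 1) * (p - 1) := Nat.mul_le_mul hpk hp1

/-- `ℚ(ζ_p)` is Galois over `ℚ`. [cite: Washington1997, Thm. 2.5] -/
theorem isGalois_of_isCyclotomicExtension_prime (p : ℕ) [IsCyclotomicExtension {p} ℚ F] : IsGalois ℚ F :=
  IsCyclotomicExtension.isGalois {p} ℚ F

/-- `[ℚ(ζ_p) : ℚ] = p − 1` for `p` prime. [cite: Washington1997, Thm. 2.5] -/
theorem finrank_of_isCyclotomicExtension_prime {p : ℕ} (hp : p.Prime) [IsCyclotomicExtension {p} ℚ F] :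
    Module.finrank ℚ F = p - 1 := by
  haveI : NeZero p := ⟨hp.ne_zero⟩
  rw [IsCyclotomicExtension.finrank F (Polynomial.cyclotomic.irreducible_rat hp.pos), Nat.totient_prime hp]

/-- `p ≥ 7` prime ⟹ `[ℚ(ζ_p) : ℚ] ≥ 6`. [folklore] -/
theorem six_le_finrank_of_isCyclotomicExtension_prime {p : ℕ} (hp : p.Prime) (h7 : 7 ≤ p) [IsCyclotomicExtension {p} ℚ F] :
    6 ≤ Module.finrank ℚ F := by
  rw [finrank_of_isCyclotomicExtension_prime hp]; omega

end Group

/-! ## §3 The `β − 1` face theorems without the instance binder -/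

section Field

variable {F : Type} [Field F] [NumberField F]

/-- **Generator form of `exists_faces_hgen_of_isCyclic`**: `F` Galois CM, every automorphism a power of `g` ⟹ a face set `𝒮` with
`|𝒮| + 1 = β(F)` and `hgen(𝒮, σ₀)`. [folklore] -/
theorem exists_faces_hgen_of_zpowers [IsCMField F] [IsGalois ℚ F] {g : F ≃ₐ[ℚ] F} (hg : ∀ x, x ∈ Subgroup.zpowers g)
    (σ₀ : F →+* ℂ) :
    ∃ 𝒮 : Finset (Face F), 𝒮.card + 1 = Fintype.card (Block (conjT : GalT F)) ∧
      ∀ f : Face F, lefChar f.corner (fun _ => ({σ₀} : Finset (F →+* ℂ))) ∈ AddSubgroup.closure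
        {a : Asym F | ∃ g ∈ (𝒮 : Set (Face F)), ∃ σ : F →+* ℂ, a = lefChar g.corner (fun _ => ({σ} : Finset (F →+* ℂ)))} := by
  haveI := isCyclic_galT_of_zpowers hg
  exact exists_faces_hgen_of_isCyclic σ₀

/-- **Generator form of `isLeast_card_faces_hgen_of_isCyclic`**: the least size of a face set with `hgen` is `β(F) − 1`. [folklore] -/
theorem isLeast_card_faces_hgen_of_zpowers [IsCMField F] [IsGalois ℚ F] {g : F ≃ₐ[ℚ] F} (hg : ∀ x, x ∈ Subgroup.zpowers g)
    (σ₀ : F →+* ℂ) :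
    IsLeast {m : ℕ | ∃ 𝒮 : Finset (Face F), 𝒮.card = m ∧
      ∀ f : Face F, lefChar f.corner (fun _ => ({σ₀} : Finset (F →+* ℂ))) ∈ AddSubgroup.closure
        {a : Asym F | ∃ g ∈ (𝒮 : Set (Face F)), ∃ σ : F →+* ℂ, a = lefChar g.corner (fun _ => ({σ} : Finset (F →+* ℂ)))}}
      (Fintype.card (Block (conjT : GalT F)) - 1) := by
  haveI := isCyclic_galT_of_zpowers hg
  exact isLeast_card_faces_hgen_of_isCyclic σ₀

/-- **`ℚ(ζ_{p^k})`, `p` an odd prime, `k ≥ 1`: a face set `𝒮` with `|𝒮| + 1 = β` and `hgen(𝒮, σ₀)`.**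
[cite: Washington1997, Thm. 2.5] -/
theorem exists_faces_hgen_of_isCyclotomicExtension_prime_pow [IsCMField F] {p k : ℕ} (hp : p.Prime) (hp2 : p ≠ 2) (hk : 0 < k)
    [IsCyclotomicExtension {p ^ k} ℚ F] (σ₀ : F →+* ℂ) :
    ∃ 𝒮 : Finset (Face F), 𝒮.card + 1 = Fintype.card (Block (conjT : GalT F)) ∧
      ∀ f : Face F, lefChar f.corner (fun _ => ({σ₀} : Finset (F →+* ℂ))) ∈ AddSubgroup.closure
        {a : Asym F | ∃ g ∈ (𝒮 : Set (Face F)), ∃ σ : F →+* ℂ, a = lefChar g.corner (fun _ => ({σ} : Finset (F →+* ℂ)))} := by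
  haveI := isGalois_of_isCyclotomicExtension_prime_pow (F := F) p k
  haveI := isCyclic_galT_of_isCyclotomicExtension_prime_pow (F := F) hp hp2 hk
  exact exists_faces_hgen_of_isCyclic σ₀

/-- **`ℚ(ζ_{p^k})`, `p` an odd prime, `k ≥ 1`: the least size of a face set with `hgen` is `β − 1`.** [cite: Washington1997, Thm. 2.5] -/
theorem isLeast_card_faces_hgen_of_isCyclotomicExtension_prime_pow [IsCMField F] {p k : ℕ} (hp : p.Prime) (hp2 : p ≠ 2)
    (hk : 0 < k) [IsCyclotomicExtension {p ^ k} ℚ F] (σ₀ : F →+* ℂ) :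
    IsLeast {m : ℕ | ∃ 𝒮 : Finset (Face F), 𝒮.card = m ∧
      ∀ f : Face F, lefChar f.corner (fun _ => ({σ₀} : Finset (F →+* ℂ))) ∈ AddSubgroup.closure
        {a : Asym F | ∃ g ∈ (𝒮 : Set (Face F)), ∃ σ : F →+* ℂ, a = lefChar g.corner (fun _ => ({σ} : Finset (F →+* ℂ)))}}
      (Fintype.card (Block (conjT : GalT F)) - 1) := by
  haveI := isGalois_of_isCyclotomicExtension_prime_pow (F := F) p k
  haveI := isCyclic_galT_of_isCyclotomicExtension_prime_pow (F := F) hp hp2 hk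
  exact isLeast_card_faces_hgen_of_isCyclic σ₀

/-- **`ℚ(ζ_p)`, `p` an odd prime: a face set `𝒮` with `|𝒮| + 1 = β` and `hgen(𝒮, σ₀)`.** [cite: Washington1997, Thm. 2.5] -/
theorem exists_faces_hgen_of_isCyclotomicExtension_prime [IsCMField F] {p : ℕ} (hp : p.Prime)
    [IsCyclotomicExtension {p} ℚ F] (σ₀ : F →+* ℂ) :
    ∃ 𝒮 : Finset (Face F), 𝒮.card + 1 = Fintype.card (Block (conjT : GalT F)) ∧
      ∀ f : Face F, lefChar f.corner (fun _ => ({σ₀} : Finset (F →+* ℂ))) ∈ AddSubgroup.closure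
        {a : Asym F | ∃ g ∈ (𝒮 : Set (Face F)), ∃ σ : F →+* ℂ, a = lefChar g.corner (fun _ => ({σ} : Finset (F →+* ℂ)))} := by
  haveI := isGalois_of_isCyclotomicExtension_prime (F := F) p
  haveI := isCyclic_galT_of_isCyclotomicExtension_prime (F := F) hp
  exact exists_faces_hgen_of_isCyclic σ₀

/-- **`ℚ(ζ_p)`, `p` an odd prime: the least size of a face set with `hgen` is `β − 1`.** [cite: Washington1997, Thm. 2.5] -/
theorem isLeast_card_faces_hgen_of_isCyclotomicExtension_prime [IsCMField F] {p : ℕ} (hp : p.Prime)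
    [IsCyclotomicExtension {p} ℚ F] (σ₀ : F →+* ℂ) :
    IsLeast {m : ℕ | ∃ 𝒮 : Finset (Face F), 𝒮.card = m ∧
      ∀ f : Face F, lefChar f.corner (fun _ => ({σ₀} : Finset (F →+* ℂ))) ∈ AddSubgroup.closure
        {a : Asym F | ∃ g ∈ (𝒮 : Set (Face F)), ∃ σ : F →+* ℂ, a = lefChar g.corner (fun _ => ({σ} : Finset (F →+* ℂ)))}}
      (Fintype.card (Block (conjT : GalT F)) - 1) := by
  haveI := isGalois_of_isCyclotomicExtension_prime (F := F) p
  haveI := isCyclic_galT_of_isCyclotomicExtension_prime (F := F) hp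
  exact isLeast_card_faces_hgen_of_isCyclic σ₀

end Field

/-- **HC for the slice of a Galois CM field with a generator of its Galois group, from `β − 1` face periods** (generator form of
`hodgeConjectureFor_of_isCyclic_of_exists_facePeriod`; INT2-GEN socket BY NAME; CONDITIONAL on the periods — `HC_CM` is NOT proved).
[cite: Shimura1998, §6.2 Theorem 3 and §6.1 Corollary of Theorem 2 (pp. 41–43)] [cite: Pohlmann1968, Thm. 1]
[cite: Milne1999LefschetzClasses, Thm. 3.2 and Cor. 4.5] [cite: MumfordAV1970, §19 Thm. 1 and p. 169] -/
theorem hodgeConjectureFor_of_zpowers_of_exists_facePeriod (K : CMField) [hGal : IsGalois ℚ K]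
    {g : ((K : Type) ≃ₐ[ℚ] (K : Type))} (hg : ∀ x, x ∈ Subgroup.zpowers g)
    (h6 : 6 ≤ Module.finrank ℚ K) (σ₀ : (K : Type) →+* ℂ) :
    ∃ 𝒮 : Finset (Face K), 𝒮.card + 1 = Fintype.card (Block (conjT : GalT K)) ∧
      ((∀ f ∈ 𝒮, ∃ ι₁ : K →+* ℂ, f.Admissible ι₁ ∧ ∃ (V : HermSpace3 K ι₁) (σ : K →+* ℂ),
        (Model.picardCMUniverse exists_isReal_hodgeModel_holds hodgePQ_independent_of_hodgeModel_holds
          BallQuotient.ballQuotientUniformised_holds cmAbelianVarietyRealised_holds).PeriodNV ι₁ V K f.psi σ) →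
      ∀ {P B : AbelianVariety ℂ}, AbelianVariety.IsProductOf (fun B : AbelianVariety ℂ =>
        ∃ (E : Type) (_ : Field E) (_ : NumberField E) (_ : IsCMField E) (_ : E →+* (K : Type)) (Φ : CMType E)
          (ι : 𝓞 E →+* End B) (θ : E →+* Module.End ℂ (complexBetti B.X 1)),
          IsCMTypeRealisation Φ B ι θ) P →
      AVDominatedBy B P → HodgeConjectureFor B.dim B.X) := by
  haveI := isCyclic_galT_of_zpowers hg
  exact hodgeConjectureFor_of_isCyclic_of_exists_facePeriod K h6 σ₀

/-- **HC FOR THE SLICE OF `ℚ(ζ_{p^k})` FROM `β − 1` FACE PERIODS** (`p` an odd prime, `p^k ≥ 7`: `ℚ(ζ₇)`, `ℚ(ζ₉)`, `ℚ(ζ₁₁)`, `ℚ(ζ₁₃)`,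
`ℚ(ζ₂₅)`, `ℚ(ζ₂₇)`, …; `K` any CM field that is a `p^k`-th cyclotomic extension of `ℚ`, e.g. `⟨CyclotomicField (p^k) ℚ⟩` with Mathlib's
`IsCyclotomicExtension.Rat.isCMField`).  For every base embedding `σ₀` there is a face set `𝒮` of `K` with `|𝒮| + 1 = β(K)` such that,
IF every face of `𝒮` has a non-vanishing period on the universe of record, THEN the Hodge conjecture holds for every abelian variety
dominated by a product of CM abelian varieties with CM by subfields of `K` (INT2-GEN socket BY NAME; CONDITIONAL on the periods —
`HC_CM` is NOT proved, no period is produced).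
[cite: Washington1997, Thm. 2.5] [cite: Shimura1998, §6.2 Theorem 3 and §6.1 Corollary of Theorem 2 (pp. 41–43)]
[cite: Pohlmann1968, Thm. 1] [cite: Milne1999LefschetzClasses, Thm. 3.2 and Cor. 4.5] [cite: MumfordAV1970, §19 Thm. 1 and p. 169] -/
theorem hodgeConjectureFor_of_isCyclotomicExtension_prime_pow_of_exists_facePeriod (K : CMField) {p k : ℕ} (hp : p.Prime)
    (hp2 : p ≠ 2) (h7 : 7 ≤ p ^ k) [IsCyclotomicExtension {p ^ k} ℚ (K : Type)] (σ₀ : (K : Type) →+* ℂ) :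
    ∃ 𝒮 : Finset (Face K), 𝒮.card + 1 = Fintype.card (Block (conjT : GalT K)) ∧
      ((∀ f ∈ 𝒮, ∃ ι₁ : K →+* ℂ, f.Admissible ι₁ ∧ ∃ (V : HermSpace3 K ι₁) (σ : K →+* ℂ),
        (Model.picardCMUniverse exists_isReal_hodgeModel_holds hodgePQ_independent_of_hodgeModel_holds
          BallQuotient.ballQuotientUniformised_holds cmAbelianVarietyRealised_holds).PeriodNV ι₁ V K f.psi σ) →
      ∀ {P B : AbelianVariety ℂ}, AbelianVariety.IsProductOf (fun B : AbelianVariety ℂ =>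
        ∃ (E : Type) (_ : Field E) (_ : NumberField E) (_ : IsCMField E) (_ : E →+* (K : Type)) (Φ : CMType E)
          (ι : 𝓞 E →+* End B) (θ : E →+* Module.End ℂ (complexBetti B.X 1)),
          IsCMTypeRealisation Φ B ι θ) P →
      AVDominatedBy B P → HodgeConjectureFor B.dim B.X) := by
  have hk : 0 < k := by
    rcases Nat.eq_zero_or_pos k with rfl | hk
    · rw [pow_zero] at h7; omega
    · exact hk
  haveI := isGalois_of_isCyclotomicExtension_prime_pow (F := (K : Type)) p k
  haveI := isCyclic_galT_of_isCyclotomicExtension_prime_pow (F := (K : Type)) hp hp2 hk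
  exact hodgeConjectureFor_of_isCyclic_of_exists_facePeriod K
    (six_le_finrank_of_isCyclotomicExtension_prime_pow (F := (K : Type)) hp hp2 h7) σ₀

/-- **HC FOR THE SLICE OF `ℚ(ζ_p)` FROM `β − 1` FACE PERIODS** (`p ≥ 7` prime; `K` any CM field that is a `p`-th cyclotomic extension of
`ℚ`).  Same statement and framing as the prime-power form (INT2-GEN socket BY NAME; CONDITIONAL on the periods — `HC_CM` is NOT proved,
no period is produced); `β(K)·(p−1) = Σ_{d ∣ p−1, d odd} φ(d)·2^{(p−1)/2d}`.
[cite: Washington1997, Thm. 2.5] [cite: Shimura1998, §6.2 Theorem 3 and §6.1 Corollary of Theorem 2 (pp. 41–43)]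
[cite: Pohlmann1968, Thm. 1] [cite: Milne1999LefschetzClasses, Thm. 3.2 and Cor. 4.5] [cite: MumfordAV1970, §19 Thm. 1 and p. 169] -/
theorem hodgeConjectureFor_of_isCyclotomicExtension_prime_of_exists_facePeriod (K : CMField) {p : ℕ} (hp : p.Prime) (h7 : 7 ≤ p)
    [IsCyclotomicExtension {p} ℚ (K : Type)] (σ₀ : (K : Type) →+* ℂ) :
    ∃ 𝒮 : Finset (Face K), 𝒮.card + 1 = Fintype.card (Block (conjT : GalT K)) ∧
      ((∀ f ∈ 𝒮, ∃ ι₁ : K →+* ℂ, f.Admissible ι₁ ∧ ∃ (V : HermSpace3 K ι₁) (σ : K →+* ℂ),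
        (Model.picardCMUniverse exists_isReal_hodgeModel_holds hodgePQ_independent_of_hodgeModel_holds
          BallQuotient.ballQuotientUniformised_holds cmAbelianVarietyRealised_holds).PeriodNV ι₁ V K f.psi σ) →
      ∀ {P B : AbelianVariety ℂ}, AbelianVariety.IsProductOf (fun B : AbelianVariety ℂ =>
        ∃ (E : Type) (_ : Field E) (_ : NumberField E) (_ : IsCMField E) (_ : E →+* (K : Type)) (Φ : CMType E)
          (ι : 𝓞 E →+* End B) (θ : E →+* Module.End ℂ (complexBetti B.X 1)),
          IsCMTypeRealisation Φ B ι θ) P →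
      AVDominatedBy B P → HodgeConjectureFor B.dim B.X) := by
  haveI := isGalois_of_isCyclotomicExtension_prime (F := (K : Type)) p
  haveI := isCyclic_galT_of_isCyclotomicExtension_prime (F := (K : Type)) hp
  exact hodgeConjectureFor_of_isCyclic_of_exists_facePeriod K
    (six_le_finrank_of_isCyclotomicExtension_prime (F := (K : Type)) hp h7) σ₀

end Summit.HodgeConjecture.CorCM.FaceCyclic

end
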